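import Summits.HodgeConjecture.CorCM.MultiFieldWeilFresh
import Summits.HodgeConjecture.CorCM.CMWeightLinesDisjointUnion
import HarnessLib

/-!
# COR-CM — MULTI-FIELD WEIL, part 5: THE ENGINE — every configuration obeying the defect law has an algebraic weight line, GIVEN ONLY the
# single-slot Weil parts (any number of CM fields of any degrees sharing `k`; every product of copies at once)

Cell `pub-hodgecm2` (COR-CM), seat b30 gen 28 (2026-08-23); count-neutral own lane MULTI-FIELD WEIL ENGINE; sequel of
`CorCM/MultiFieldWeilFresh.lean`.  Theorems only; no definition, no named fact, no `sorry`.  Nothing about the Hodge conjecture is concluded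
in this file (the assembly is `CorCM/MultiFieldWeilHodge.lean`); `HC_CM` is not asserted.

THE ENGINE (`weightClassesAlg_le_algebraicClasses_of_hasDefectsG`).  Data: slots `(k; K_1, …, K_r)`, frames `e_m`, realisations `A j` of the
slot types, curve multiplicities `c_m < n_m` and part sizes `w_m` with `n_m + c_m = 2 w_m`.  HYPOTHESIS `hpart` (the single-slot Weil parts):
for every field `m`, sign `s` and EVERY product of copies `X' = ⨁_j A(κ' j)`, a weight of `X'` consisting of `c_m` coordinates over `τ_s` and
ONE LAYER of `K_m` of sign `s` (one coordinate over each conjugate pair) spans a line of algebraic classes — the Weil class of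
`B_m × E^{c_m}` read on `X'` (Markman-type inputs, supplied per instance by `CorCM/MultiFieldWeilParts.lean`).  CONCLUSION: for every product
of copies `X = ⨁_j A(κ j)` and every configuration `T` of its coordinates obeying the DEFECT LAW `d_m ≡ t_m`, `e = Σ_m c_m t_m`
(`HasDefectsG`), the weight line `H^{2p}(X)_T` consists of algebraic classes.
PROOF — strong induction on `|T|`, SIMULTANEOUSLY over all products of copies: (0) `T = ∅`: degree `0`.  (1) All `t_m = 0`: `T` contains two
coordinates over conjugate model points (`exists_conj_of_hasDefects_zero`); they span a divisor line (`…_of_pairG`), the rest obeys the law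
with the same defects (`hasDefectsG_sdiff_pair`); induct and multiply (`CMWeights.weightClassesAlg_union_le_algebraicClasses`).  (2) Some
`t_{m₀} ≠ 0`: `T` contains a layer `L` of `K_{m₀}` of the sign `s` of `t_{m₀}` (`exists_layer_of_hasDefects`).  Adjoin `c_{m₀}` FRESH curves:
on `X⁺ = E^{c_{m₀}} ⊞ X` the weight `up(T) ⊔ (all fresh coordinates)` splits as `W ⊔ T₁`, `W` = (the fresh coordinates over `τ_s`) ⊔ `up(L)` —
a single-slot Weil part, algebraic by `hpart` — and `T₁ = up(T ∖ L) ⊔` (the fresh coordinates over `τ_{¬s}`), which obeys the law with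
`t_{m₀}` replaced by `t_{m₀} − sgn s` (`hasDefectsG_step`) and has `|T₁| = |T| − n_{m₀} + c_{m₀} < |T|`; induct, multiply, and DESCEND to `X`
(`descend`: gen 21ʼs push-forward extraction, one fresh curve at a time).  No minimal-part census, no cross parts: the eightfold / tenfold /
twelvefold / fourteenfold Weil classes of the earlier chains are instances of step (2).
[cite: MoonenZarhin1995Duke, Thm. 2.4] [cite: Milne2020HodgeClassesAV, 1.2 (a) and Thm. 1] [cite: Schoen1998HodgeWeilAddendum, §10]
[cite: Gordon1999HodgeAVSurvey, 5.13 (ii), 9.2.2]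

## References
* [MoonenZarhin1995Duke] B. Moonen, Yu. Zarhin, Duke Math. J. 77 (1995), Thm. 2.4.  [Milne2020HodgeClassesAV] J. S. Milne, arXiv:2010.08857,
  1.2 (a), Thm. 1.  [Schoen1998HodgeWeilAddendum] C. Schoen, Compositio Math. 114 (1998), §10.  [Gordon1999HodgeAVSurvey] B. B. Gordon,
  CRM Monogr. 10 (1999), 5.13 (ii), 9.2.2.
-/

noncomputable section

open CategoryTheory CategoryTheory.Limits NumberField

namespace Summit.HodgeConjecture.CorCM.MultiFieldWeil

open Literature.AlgebraicGeometry Literature.AlgebraicGeometry.Motives Literature.AlgebraicGeometry.HodgeTheory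
open Literature.AlgebraicGeometry.ComplexMultiplication (IsCMTypeRealisation)
open Literature.AlgebraicGeometry.Pohlmann1968
open Literature.AlgebraicTopology.SingularHomology
open Literature.NumberTheory.ComplexMultiplication
open Summit.HodgeConjecture.CorCM.Census.MultiFieldWeil
open Summit.HodgeConjecture.CorCM.PairWeights (weightClassesAlg_union_le_algebraicClasses)

open scoped Classical Pointwise

/-! ## §1 Fibre-count bookkeeping: pairs, fresh coordinates, the step -/

section Counts

variable {r : ℕ} {n : Fin r → ℕ} {α : Type*} [DecidableEq α] {v : α → PtG n}

/-- The fibre counts of two points. [folklore] -/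
theorem cnt_pair {x x' : α} (hne : x ≠ x') (y : PtG n) :
    cnt v ({x, x'} : Finset α) y = (if v x = y then 1 else 0) + (if v x' = y then 1 else 0) := by
  rw [cnt, Finset.filter_insert, Finset.filter_singleton]
  by_cases h : v x = y <;> by_cases h' : v x' = y
  · rw [if_pos h, if_pos h', if_pos h, if_pos h', Finset.card_pair hne]
  · rw [if_pos h, if_neg h', if_pos h, if_neg h', Finset.insert_empty, Finset.card_singleton]
  · rw [if_neg h, if_pos h', if_neg h, if_pos h', Finset.card_singleton]
  · rw [if_neg h, if_neg h', if_neg h, if_neg h', Finset.card_empty]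

/-- **Two points over conjugate model points have conjugation-invariant fibre counts.** [folklore] -/
theorem cnt_pair_cjG {x x' : α} (hne : x ≠ x') (hv : v x' = cjG (v x)) (y : PtG n) :
    cnt v ({x, x'} : Finset α) (cjG y) = cnt v ({x, x'} : Finset α) y := by
  rw [cnt_pair hne, cnt_pair hne, hv]
  have h1 : (cjG (v x) = cjG y) = (v x = y) := propext cjG_injective.eq_iff
  have h2 : (v x = cjG y) = (cjG (v x) = y) := propext
    ⟨fun h => by rw [h, cjG_cjG], fun h => by rw [← h, cjG_cjG]⟩
  simp only [h1, h2]
  ring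

/-- **Removing two points over conjugate model points keeps the defects.** [folklore] -/
theorem hasDefectsG_sdiff_pair {c : Fin r → ℕ} {T : Finset α} {t : Fin r → ℤ} (hT : HasDefectsG c v T t) {x x' : α} (hx : x ∈ T)
    (hx' : x' ∈ T) (hne : x ≠ x') (hv : v x' = cjG (v x)) : HasDefectsG c v (T \ {x, x'}) t := by
  have hGT : ({x, x'} : Finset α) ⊆ T := Finset.insert_subset hx (Finset.singleton_subset_iff.2 hx')
  obtain ⟨hd, he⟩ := hT
  have key : ∀ y : PtG n, (cnt v (T \ {x, x'}) y : ℤ) - cnt v (T \ {x, x'}) (cjG y) = cnt v T y - cnt v T (cjG y) := by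
    intro y
    rw [cnt_sdiff hGT, cnt_sdiff hGT, Nat.cast_sub (cnt_le_cnt_of_subset hGT _), Nat.cast_sub (cnt_le_cnt_of_subset hGT _),
      cnt_pair_cjG hne hv]
    ring
  constructor
  · intro m a
    have h := key (Sum.inr ⟨m, (a, true)⟩)
    rw [cjG_inr] at h
    rw [← hd m a]
    exact h
  · have h := key (Sum.inl true)
    rw [cjG_inl] at h
    rw [← he]
    exact h

/-- Which layer labels a field point lies over. [folklore] -/
theorem ite_exists_label_eq (m m₀ : Fin r) (a : Fin (n m)) (b s : Bool) :
    (if ∃ a' : Fin (n m₀), (Sum.inr ⟨m, (a, b)⟩ : PtG n) = Sum.inr ⟨m₀, (a', s)⟩ then (1 : ℤ) else 0) =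
      if m = m₀ ∧ b = s then 1 else 0 := by
  by_cases hm : m = m₀
  · subst hm
    by_cases hb : b = s
    · subst hb
      rw [if_pos ⟨a, rfl⟩, if_pos ⟨rfl, rfl⟩]
    · have hne : ¬ ∃ a' : Fin (n m), (Sum.inr ⟨m, (a, b)⟩ : PtG n) = Sum.inr ⟨m, (a', s)⟩ := by
        rintro ⟨a', h⟩
        simp only [Sum.inr.injEq, Sigma.mk.injEq, heq_eq_eq, Prod.mk.injEq, true_and] at h
        exact hb h.2
      rw [if_neg hne, if_neg (fun h => hb h.2)]
  · have hne : ¬ ∃ a' : Fin (n m₀), (Sum.inr ⟨m, (a, b)⟩ : PtG n) = Sum.inr ⟨m₀, (a', s)⟩ := by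
      rintro ⟨a', h⟩
      simp only [Sum.inr.injEq, Sigma.mk.injEq] at h
      exact hm h.1
    rw [if_neg hne, if_neg (fun h => hm h.1)]

/-- A curve point lies over no layer label. [folklore] -/
theorem not_exists_label_inl (m₀ : Fin r) (b s : Bool) : ¬ ∃ a' : Fin (n m₀), (Sum.inl b : PtG n) = Sum.inr ⟨m₀, (a', s)⟩ :=
  fun ⟨_, h⟩ => Sum.inl_ne_inr h

end Counts

section Step

variable {I : Type} {r : ℕ} {Kf : I → Type} [∀ i, Field (Kf i)] {i₀ : I} {is : Fin r → I} {n : Fin r → ℕ} {N : ℕ}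
  {e : ∀ m : Fin r, (Kf (is m) →+* ℂ) ≃ Fin (n m) × Bool} {τ : Kf i₀ →+* ℂ} (hττ : ComplexEmbedding.conjugate τ ≠ τ)

include hττ in
/-- **The fibre counts of the fresh coordinates over `τ_b`**: `c` over `inl b`, none elsewhere. [folklore] -/
theorem cnt_freshSide (κ : Fin N → Fin (r + 1)) (c : ℕ) (b : Bool) (y : PtG n) :
    cnt (vG e τ (extEN κ c)) (freshSide is τ κ c b) y = if y = Sum.inl b then c else 0 := by
  rw [cnt]
  split_ifs with h
  · rw [Finset.filter_true_of_mem fun x hx => (vG_of_mem_freshSide e hττ κ c b hx).trans h.symm]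
    exact card_freshSide κ c b
  · rw [Finset.card_eq_zero, Finset.filter_eq_empty_iff]
    intro x hx hvx
    exact h (hvx ▸ vG_of_mem_freshSide e hττ κ c b hx)

include hττ in
/-- **THE STEP ON THE DEFECTS.**  Remove a layer `L ⊆ T` of the field `m₀` of sign `s`, move to `X⁺ = E^{c_{m₀}} ⊞ X`, and add the
`c_{m₀}` fresh coordinates over `τ_{¬s}`: the new configuration obeys the defect law with `t_{m₀}` replaced by `t_{m₀} − sgn s`
(`e` drops by `c_{m₀} · sgn s = c_{m₀} · (t_{m₀} − (t_{m₀} − sgn s))`). [cite: MoonenZarhin1995Duke, Thm. 2.4] -/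
theorem hasDefectsG_step (c : Fin r → ℕ) (κ : Fin N → Fin (r + 1)) {T L : Finset (Crd Kf i₀ is κ)} {t : Fin r → ℤ}
    (hT : HasDefectsG c (vG e τ κ) T t) {m₀ : Fin r} {s : Bool} (hLT : L ⊆ T) (hL : IsLayerG (vG e τ κ) m₀ s L) :
    HasDefectsG c (vG e τ (extEN κ (c m₀)))
      ((T \ L).map (upENEmb is κ (c m₀)) ∪ freshSide is τ κ (c m₀) (!s)) (Function.update t m₀ (t m₀ - sgnZ s)) := by
  obtain ⟨hd, he⟩ := hT
  have hdisj : Disjoint ((T \ L).map (upENEmb is κ (c m₀))) (freshSide is τ κ (c m₀) (!s)) :=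
    (disjoint_freshSide_map κ (c m₀) (!s) (T \ L)).symm
  -- the new fibre counts
  have key : ∀ y : PtG n, (cnt (vG e τ (extEN κ (c m₀))) ((T \ L).map (upENEmb is κ (c m₀)) ∪ freshSide is τ κ (c m₀) (!s)) y : ℤ) =
      cnt (vG e τ κ) T y - (if ∃ a : Fin (n m₀), y = Sum.inr ⟨m₀, (a, s)⟩ then 1 else 0) + (if y = Sum.inl (!s) then (c m₀ : ℤ) else 0) := by
    intro y
    rw [cnt_union hdisj, cnt_map_eq (upENEmb is κ (c m₀)) (vG_upENEmb e κ (c m₀)) (T \ L) y, Nat.cast_add, cnt_sdiff_layer hLT hL,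
      cnt_freshSide hττ κ (c m₀) (!s) y]
    push_cast
    rfl
  constructor
  · intro m a
    rw [key, key, ite_exists_label_eq, ite_exists_label_eq, if_neg Sum.inr_ne_inl, if_neg Sum.inr_ne_inl]
    by_cases hm : m = m₀
    · subst hm
      rw [Function.update_self, ← hd m a]
      cases s
      · rw [if_neg (fun h => Bool.noConfusion h.2), if_pos ⟨rfl, rfl⟩, sgnZ_false]; ring
      · rw [if_pos ⟨rfl, rfl⟩, if_neg (fun h => Bool.noConfusion h.2), sgnZ_true]; ring
    · rw [Function.update_of_ne hm, if_neg (fun h => hm h.1), if_neg (fun h => hm h.1), ← hd m a]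
      ring
  · rw [key, key, if_neg (not_exists_label_inl m₀ true s), if_neg (not_exists_label_inl m₀ false s)]
    have hsum : ∑ m : Fin r, (c m : ℤ) * Function.update t m₀ (t m₀ - sgnZ s) m = (∑ m : Fin r, (c m : ℤ) * t m) - c m₀ * sgnZ s := by
      have h1 : ∀ m : Fin r, (c m : ℤ) * Function.update t m₀ (t m₀ - sgnZ s) m = (c m : ℤ) * t m - if m = m₀ then (c m₀ : ℤ) * sgnZ s else 0 := by
        intro m
        by_cases hm : m = m₀
        · subst hm; rw [Function.update_self, if_pos rfl]; ring
        · rw [Function.update_of_ne hm, if_neg hm]; ring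
      rw [Finset.sum_congr rfl fun m _ => h1 m, Finset.sum_sub_distrib, Finset.sum_ite_eq' Finset.univ m₀, if_pos (Finset.mem_univ _)]
    rw [hsum, ← he]
    cases s
    · simp only [Bool.not_false, if_true, Sum.inl.injEq, Bool.false_eq_true, if_false, sgnZ_false]; ring
    · simp only [Bool.not_true, Sum.inl.injEq, Bool.true_eq_false, if_false, if_true, sgnZ_true]; ring

/-- **A layer stays a layer along `upENEmb`.** [folklore] -/
theorem IsLayerG.map_upENEmb (κ : Fin N → Fin (r + 1)) (c : ℕ) {m₀ : Fin r} {s : Bool} {L : Finset (Crd Kf i₀ is κ)}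
    (hL : IsLayerG (vG e τ κ) m₀ s L) : IsLayerG (vG e τ (extEN κ c)) m₀ s (L.map (upENEmb is κ c)) :=
  ⟨by rw [Finset.card_map, hL.1], fun a => by rw [cnt_map_eq (upENEmb is κ c) (vG_upENEmb e κ c) L, hL.2 a]⟩

/-- **The split on `X⁺`**: `up(T) ⊔ (all fresh) = W ⊔ T₁`, `W =` fresh over `τ_s` `⊔ up(L)`, `T₁ = up(T ∖ L) ⊔` fresh over `τ_{¬s}`. [folklore] -/
theorem map_union_fresh_eq (κ : Fin N → Fin (r + 1)) (c : ℕ) {T L : Finset (Crd Kf i₀ is κ)} (hLT : L ⊆ T) (s : Bool) :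
    T.map (upENEmb is κ c) ∪ (freshSide is τ κ c true ∪ freshSide is τ κ c false) =
      (freshSide is τ κ c s ∪ L.map (upENEmb is κ c)) ∪ ((T \ L).map (upENEmb is κ c) ∪ freshSide is τ κ c (!s)) := by
  conv_lhs => rw [← Finset.union_sdiff_of_subset hLT, Finset.map_union]
  ext x
  simp only [Finset.mem_union]
  cases s <;> simp only [Bool.not_true, Bool.not_false] <;> tauto

include hττ in
/-- **The two halves of the split are disjoint.** [folklore] -/
theorem disjoint_split (κ : Fin N → Fin (r + 1)) (c : ℕ) {T L : Finset (Crd Kf i₀ is κ)} (s : Bool) :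
    Disjoint (freshSide is τ κ c s ∪ L.map (upENEmb is κ c)) ((T \ L).map (upENEmb is κ c) ∪ freshSide is τ κ c (!s)) := by
  rw [Finset.disjoint_union_left, Finset.disjoint_union_right, Finset.disjoint_union_right]
  refine ⟨⟨disjoint_freshSide_map κ c s _, ?_⟩, ⟨?_, (disjoint_freshSide_map κ c (!s) L).symm⟩⟩
  · cases s
    · exact (disjoint_freshSide hττ κ c).symm
    · exact disjoint_freshSide hττ κ c
  · rw [Finset.disjoint_map]
    exact Finset.disjoint_sdiff

end Step

/-! ## §2 The engine -/

section Engine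

variable {I : Type} {r : ℕ} {Kf : I → Type} [∀ i, Field (Kf i)] [∀ i, NumberField (Kf i)] [∀ i, IsCMField (Kf i)]
  {i₀ : I} {is : Fin r → I} {n : Fin r → ℕ}
  {e : ∀ m : Fin r, (Kf (is m) →+* ℂ) ≃ Fin (n m) × Bool} {τ : Kf i₀ →+* ℂ}
  (hττ : ComplexEmbedding.conjugate τ ≠ τ) (hk : ∀ σ : Kf i₀ →+* ℂ, σ = τ ∨ σ = ComplexEmbedding.conjugate τ)
  (he_conj : ∀ (m : Fin r) (s : Kf (is m) →+* ℂ), e m (ComplexEmbedding.conjugate s) = ((e m s).1, !(e m s).2))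
  {A : Fin (r + 1) → AbelianVariety ℂ} {Φ : ∀ j : Fin (r + 1), CMType (Kf (mfSlots i₀ is j))}
  {ι : ∀ j, 𝓞 (Kf (mfSlots i₀ is j)) →+* End (A j)}
  {θ : ∀ j, Kf (mfSlots i₀ is j) →+* Module.End ℂ (complexBetti (A j).X 1)}
  (hA : ∀ j, IsCMTypeRealisation (Φ j) (A j) (ι j) (θ j))

include hττ hk he_conj hA in
/-- **THE MULTI-FIELD WEIL ENGINE.**  Given the single-slot Weil parts (`hpart`: on EVERY product of copies, `c_m` coordinates over `τ_s` and one
layer of `K_m` of sign `s` span a line of algebraic classes, of degree `w_m`, `n_m + c_m = 2 w_m`, `c_m < n_m`), EVERY configuration of EVERY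
product of copies `X = ⨁_j A(κ j)` obeying the defect law `d_m ≡ t_m`, `e = Σ_m c_m t_m` has a weight line `H^{2p}(X)_T ⊆ Nᵖ H^{2p}(X)`.
Proof in the module docstring (strong induction on `|T|` over all products of copies; conjugate pairs; layers with fresh curves; descent).
[cite: MoonenZarhin1995Duke, Thm. 2.4] [cite: Milne2020HodgeClassesAV, 1.2 (a) and Thm. 1] [cite: Schoen1998HodgeWeilAddendum, §10] -/
theorem weightClassesAlg_le_algebraicClasses_of_hasDefectsG (c w : Fin r → ℕ) (hw : ∀ m, n m + c m = 2 * w m) (hcn : ∀ m, c m < n m)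
    (hpart : ∀ (m : Fin r) (s : Bool) {N' : ℕ} (κ' : Fin N' → Fin (r + 1)) (C L : Finset (Crd Kf i₀ is κ')),
      Disjoint C L → C.card = c m → (∀ x ∈ C, vG e τ κ' x = Sum.inl s) → IsLayerG (vG e τ κ') m s L →
      weightClassesAlg (fun j => A (κ' j)) (fun j => ι (κ' j)) (2 * w m) (C ∪ L) ≤ algebraicClasses (⨁ fun j => A (κ' j)).X (w m))
    {N : ℕ} (κ : Fin N → Fin (r + 1)) {T : Finset (Crd Kf i₀ is κ)} {t : Fin r → ℤ} (hT : HasDefectsG c (vG e τ κ) T t)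
    {p : ℕ} (hp : T.card = 2 * p) :
    weightClassesAlg (fun j => A (κ j)) (fun j => ι (κ j)) (2 * p) T ≤ algebraicClasses (⨁ fun j => A (κ j)).X p := by
  -- strong induction on the size, over all products of copies at once
  suffices key : ∀ (k : ℕ) {N : ℕ} (κ : Fin N → Fin (r + 1)) (T : Finset (Crd Kf i₀ is κ)) (t : Fin r → ℤ) (p : ℕ),
      T.card = k → HasDefectsG c (vG e τ κ) T t → T.card = 2 * p →
      weightClassesAlg (fun j => A (κ j)) (fun j => ι (κ j)) (2 * p) T ≤ algebraicClasses (⨁ fun j => A (κ j)).X p from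
    key _ κ T t p rfl hT hp
  intro k
  induction k using Nat.strong_induction_on with
  | _ k ih => ?_
  intro N κ T t p hTk hT hp
  have hAκ : ∀ j, IsCMTypeRealisation (Φ (κ j)) (A (κ j)) (ι (κ j)) (θ (κ j)) := fun j => hA (κ j)
  by_cases hT0 : T = ∅
  · -- (0) the empty weight: degree `0`
    subst hT0
    obtain rfl : p = 0 := by rw [Finset.card_empty] at hp; omega
    exact fun c' _ => hodgeConjectureFor_codim_zero c'
  by_cases ht : ∀ m, t m = 0
  · -- (1) all defects vanish: a conjugate pair
    obtain ⟨x, hx, x', hx', hne, hv⟩ := exists_conj_of_hasDefects_zero hT ht (Finset.nonempty_iff_ne_empty.2 hT0)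
    obtain ⟨hGcard, hGalg⟩ := weightClassesAlg_le_algebraicClasses_of_pairG κ hττ hk he_conj hA (x := x) (x' := x') hv
    have hGT : ({x, x'} : Finset (Crd Kf i₀ is κ)) ⊆ T := Finset.insert_subset hx (Finset.singleton_subset_iff.2 hx')
    have hrest := hasDefectsG_sdiff_pair hT hx hx' hne hv
    have hcardR : (T \ {x, x'}).card = 2 * (p - 1) := by
      rw [Finset.card_sdiff_of_subset hGT, hp, hGcard]; omega
    have hlt : (T \ {x, x'}).card < k := by
      rw [Finset.card_sdiff_of_subset hGT, hGcard, hTk]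
      have : 0 < T.card := Finset.card_pos.2 ⟨x, hx⟩
      omega
    have hRalg := ih _ hlt κ (T \ {x, x'}) t (p - 1) rfl hrest hcardR
    have hq : 1 + (p - 1) = p := by
      have h := Finset.card_sdiff_of_subset hGT; rw [hp, hGcard] at h; omega
    have h := weightClassesAlg_union_le_algebraicClasses hAκ hq hGcard hcardR Finset.disjoint_sdiff hGalg hRalg
    rw [Finset.disjUnion_eq_union, Finset.union_sdiff_of_subset hGT] at h
    exact h
  · -- (2) a non-zero defect: a layer, fresh curves, the step, descent
    obtain ⟨m₀, hm₀⟩ := not_forall.1 ht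
    obtain ⟨s, L, hLT, hL, -⟩ := exists_layer_of_hasDefects hT hm₀
    have hAκ' : ∀ l, IsCMTypeRealisation (Φ (extEN κ (c m₀) l)) (A (extEN κ (c m₀) l)) (ι (extEN κ (c m₀) l)) (θ (extEN κ (c m₀) l)) :=
      fun l => hA (extEN κ (c m₀) l)
    -- sizes
    have hLcard : L.card = n m₀ := hL.1
    have hnT : n m₀ ≤ T.card := hLcard ▸ Finset.card_le_card hLT
    have hWcard : (freshSide is τ κ (c m₀) s ∪ L.map (upENEmb is κ (c m₀))).card = 2 * w m₀ := by
      rw [Finset.card_union_of_disjoint (disjoint_freshSide_map κ (c m₀) s L), card_freshSide, Finset.card_map, hLcard, ← hw m₀, add_comm]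
    have hT₁card : ((T \ L).map (upENEmb is κ (c m₀)) ∪ freshSide is τ κ (c m₀) (!s)).card = 2 * (p + c m₀ - w m₀) := by
      rw [Finset.card_union_of_disjoint (disjoint_freshSide_map κ (c m₀) (!s) (T \ L)).symm, Finset.card_map,
        Finset.card_sdiff_of_subset hLT, card_freshSide, hLcard, hp]
      have h := hw m₀
      omega
    have hlt : ((T \ L).map (upENEmb is κ (c m₀)) ∪ freshSide is τ κ (c m₀) (!s)).card < k := by
      rw [Finset.card_union_of_disjoint (disjoint_freshSide_map κ (c m₀) (!s) (T \ L)).symm, Finset.card_map,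
        Finset.card_sdiff_of_subset hLT, card_freshSide, hLcard, ← hTk]
      have h := hcn m₀
      omega
    have hq : w m₀ + (p + c m₀ - w m₀) = p + c m₀ := by
      have h := hw m₀; omega
    -- the part and the remainder
    have hWalg := hpart m₀ s (extEN κ (c m₀)) (freshSide is τ κ (c m₀) s) (L.map (upENEmb is κ (c m₀)))
      (disjoint_freshSide_map κ (c m₀) s L) (card_freshSide κ (c m₀) s) (fun x hx => vG_of_mem_freshSide e hττ κ (c m₀) s hx)
      (IsLayerG.map_upENEmb κ (c m₀) hL)
    have hT₁alg := ih _ hlt (extEN κ (c m₀)) _ _ (p + c m₀ - w m₀) rfl (hasDefectsG_step hττ c κ hT hLT hL) hT₁card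
    have h := weightClassesAlg_union_le_algebraicClasses hAκ' hq hWcard hT₁card (disjoint_split hττ κ (c m₀) s) hWalg hT₁alg
    rw [Finset.disjUnion_eq_union, ← map_union_fresh_eq κ (c m₀) hLT s] at h
    exact descend hττ hk hA κ (c m₀) hp h

end Engine

end Summit.HodgeConjecture.CorCM.MultiFieldWeil

end
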